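import Literature.Topology.FourManifolds.ResolutionNeckPiece
import Literature.Topology.FourManifolds.CoordinateBoxes
import Literature.Geometry.Manifold.ModelChange
import Mathlib.Analysis.SpecialFunctions.Complex.Circle
import HarnessLib

/-!
# Coordinate balls of the quarter and mixed torus charts lie in angular boxes

Bookkeeping for the assembly of the tube of `Σ̄₂ ⊂ T⁴ # ℂℙ²bar` (Akhmedov–Park, Invent. Math.
181 (2010), §3; topic `Literature/Topology/FourManifolds`, everything PROVED, no definitions).
For the scaled quarter chart `e` of the torus `T = Rechart f (S¹ × S¹)` at `(θ₁, θ₂)`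
(`TorusQuarterChart.lean`: `e x = c′ · (Im w₁²/Re w₁², Im w₂²/Re w₂²)`, `wᵢ = zᵢ θᵢ⁻¹`) a bound
`‖e x‖ ≤ μ ≤ c′` on the complex coordinate forces `Re wᵢ ≥ 1 - (μ/c′)²/2`
(`re_ge_of_norm_quarterChart_le`, from `CoordinateBoxes.re_ge_of_abs_quarterCoord_le`); the same
for the mixed chart (`re_ge_of_norm_mixedChart_le`, half coordinate in the second factor).  These
place the neck and cap zones `{‖a‖ < 2}` inside the boxes on which the framing functions are exact
(`BraidAxisFraming.lean`) and separate the two plumbing regions.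

## References

* A. Akhmedov, B. D. Park, Invent. Math. 181 (2010) 577–603, §3. [AkhmedovPark2010]
-/

noncomputable section

open scoped Manifold ContDiff Topology
open Set Function Complex
open Literature.Geometry.Manifold (Rechart)

namespace Literature.Topology.FourManifolds

namespace ChartBoxes

variable {f : ModelProd (EuclideanSpace ℝ (Fin 1)) (EuclideanSpace ℝ (Fin 1)) ≃ₜ EuclideanSpace ℝ (Fin 2)}
  {cx : EuclideanSpace ℝ (Fin 2) → ℂ}
  {e : OpenPartialHomeomorph (Rechart f (Circle × Circle)) (EuclideanSpace ℝ (Fin 2))}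
  {θ₁ θ₂ : Circle} {c' : ℝ}

variable (hcx : ∀ v, cx v = ⟨v 0, v 1⟩)

include hcx in
/-- Components are bounded by the norm of the complex coordinate. [folklore] -/
theorem abs_apply_le_norm_cx (v : EuclideanSpace ℝ (Fin 2)) : |v 0| ≤ ‖cx v‖ ∧ |v 1| ≤ ‖cx v‖ := by
  have h0 : (cx v).re = v 0 := by rw [hcx]
  have h1 : (cx v).im = v 1 := by rw [hcx]
  constructor
  · have := Complex.abs_re_le_norm (cx v); rwa [h0] at this
  · have := Complex.abs_im_le_norm (cx v); rwa [h1] at this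

/-- From `|c′ q| ≤ μ`, `0 < c′`: `|q| ≤ μ / c′`. [folklore] -/
theorem abs_le_div_of_abs_mul_le {c' q μ : ℝ} (hc' : 0 < c') (h : |c' * q| ≤ μ) : |q| ≤ μ / c' := by
  rw [abs_mul, abs_of_pos hc'] at h
  rw [le_div_iff₀ hc']; linarith [mul_comm c' |q|]

include hcx in
/-- **Quarter chart balls lie in angular boxes.**  If `x ∈ e.source` and `‖cx (e x)‖ ≤ μ` with
`0 ≤ μ ≤ c′`, then `Re (z₁ θ₁⁻¹) ≥ 1 - (μ/c′)²/2` and `Re (z₂ θ₂⁻¹) ≥ 1 - (μ/c′)²/2`.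
[cite: AkhmedovPark2010, §3] -/
theorem re_ge_of_norm_quarterChart_le (hc' : 0 < c')
    (hes : e.source = {x | (0 < ((((Rechart.out f (Circle × Circle) x).1 * θ₁⁻¹ : Circle) : ℂ)).re ∧
        0 < ((((Rechart.out f (Circle × Circle) x).1 * θ₁⁻¹ : Circle) : ℂ) ^ 2).re) ∧
      (0 < ((((Rechart.out f (Circle × Circle) x).2 * θ₂⁻¹ : Circle) : ℂ)).re ∧
        0 < ((((Rechart.out f (Circle × Circle) x).2 * θ₂⁻¹ : Circle) : ℂ) ^ 2).re)})
    (hev : ∀ x, e x 0 = c' * ((((((Rechart.out f (Circle × Circle) x).1 * θ₁⁻¹ : Circle) : ℂ) ^ 2).im /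
          ((((Rechart.out f (Circle × Circle) x).1 * θ₁⁻¹ : Circle) : ℂ) ^ 2).re)) ∧
        e x 1 = c' * ((((((Rechart.out f (Circle × Circle) x).2 * θ₂⁻¹ : Circle) : ℂ) ^ 2).im /
          ((((Rechart.out f (Circle × Circle) x).2 * θ₂⁻¹ : Circle) : ℂ) ^ 2).re)))
    {x : Rechart f (Circle × Circle)} (hx : x ∈ e.source) {μ : ℝ} (hμ0 : 0 ≤ μ) (hμ : μ ≤ c')
    (hn : ‖cx (e x)‖ ≤ μ) :
    1 - (μ / c') ^ 2 / 2 ≤ ((((Rechart.out f (Circle × Circle) x).1 * θ₁⁻¹ : Circle)) : ℂ).re ∧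
      1 - (μ / c') ^ 2 / 2 ≤ ((((Rechart.out f (Circle × Circle) x).2 * θ₂⁻¹ : Circle)) : ℂ).re := by
  rw [hes] at hx
  obtain ⟨⟨h1, h1'⟩, ⟨h2, h2'⟩⟩ := hx
  obtain ⟨e0, e1⟩ := hev x
  obtain ⟨b0, b1⟩ := abs_apply_le_norm_cx hcx (e x)
  rw [e0] at b0; rw [e1] at b1
  have ht0 : 0 ≤ μ / c' := div_nonneg hμ0 hc'.le
  have ht1 : μ / c' ≤ 1 := by rw [div_le_one hc']; exact hμ
  exact ⟨CoordinateBoxes.re_ge_of_abs_quarterCoord_le ht0 ht1 h1 h1'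
      (abs_le_div_of_abs_mul_le hc' (b0.trans hn)),
    CoordinateBoxes.re_ge_of_abs_quarterCoord_le ht0 ht1 h2 h2'
      (abs_le_div_of_abs_mul_le hc' (b1.trans hn))⟩

include hcx in
/-- **Mixed chart balls lie in angular boxes** (quarter coordinate in the first factor, half
coordinate in the second). [cite: AkhmedovPark2010, §3] -/
theorem re_ge_of_norm_mixedChart_le (hc' : 0 < c')
    (hes : e.source = {x | (0 < ((((Rechart.out f (Circle × Circle) x).1 * θ₁⁻¹ : Circle) : ℂ)).re ∧
        0 < ((((Rechart.out f (Circle × Circle) x).1 * θ₁⁻¹ : Circle) : ℂ) ^ 2).re) ∧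
      0 < ((((Rechart.out f (Circle × Circle) x).2 * θ₂⁻¹ : Circle) : ℂ)).re})
    (hev : ∀ x, e x 0 = c' * ((((((Rechart.out f (Circle × Circle) x).1 * θ₁⁻¹ : Circle) : ℂ) ^ 2).im /
          ((((Rechart.out f (Circle × Circle) x).1 * θ₁⁻¹ : Circle) : ℂ) ^ 2).re)) ∧
        e x 1 = c' * ((((Rechart.out f (Circle × Circle) x).2 * θ₂⁻¹ : Circle) : ℂ).im /
          (((Rechart.out f (Circle × Circle) x).2 * θ₂⁻¹ : Circle) : ℂ).re))
    {x : Rechart f (Circle × Circle)} (hx : x ∈ e.source) {μ : ℝ} (hμ0 : 0 ≤ μ) (hμ : μ ≤ c')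
    (hn : ‖cx (e x)‖ ≤ μ) :
    1 - (μ / c') ^ 2 / 2 ≤ ((((Rechart.out f (Circle × Circle) x).1 * θ₁⁻¹ : Circle)) : ℂ).re ∧
      1 - (μ / c') ^ 2 / 2 ≤ ((((Rechart.out f (Circle × Circle) x).2 * θ₂⁻¹ : Circle)) : ℂ).re := by
  rw [hes] at hx
  obtain ⟨⟨h1, h1'⟩, h2⟩ := hx
  obtain ⟨e0, e1⟩ := hev x
  obtain ⟨b0, b1⟩ := abs_apply_le_norm_cx hcx (e x)
  rw [e0] at b0; rw [e1] at b1
  have ht0 : 0 ≤ μ / c' := div_nonneg hμ0 hc'.le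
  have ht1 : μ / c' ≤ 1 := by rw [div_le_one hc']; exact hμ
  exact ⟨CoordinateBoxes.re_ge_of_abs_quarterCoord_le ht0 ht1 h1 h1'
      (abs_le_div_of_abs_mul_le hc' (b0.trans hn)),
    CoordinateBoxes.re_ge_of_abs_halfCoord_le ht0 ht1 h2
      (abs_le_div_of_abs_mul_le hc' (b1.trans hn))⟩

/-- **Numerics of the box level**: with `c′² ≥ 160/S²` (`S > 0`) and `μ ≤ 2`,
`1 - (μ/c′)²/2 ≥ 1 - S²/80`. [folklore] -/
theorem boxLevel_le {S c' μ : ℝ} (hS : 0 < S) (hc' : 0 < c') (hc'S : 160 / S ^ 2 ≤ c' ^ 2)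
    (hμ0 : 0 ≤ μ) (hμ : μ ≤ 2) : 1 - S ^ 2 / 80 ≤ 1 - (μ / c') ^ 2 / 2 := by
  have hS2 : 0 < S ^ 2 := by positivity
  have h1 : (μ / c') ^ 2 ≤ 4 / c' ^ 2 := by
    rw [div_pow, div_le_div_iff_of_pos_right (by positivity)]; nlinarith
  have h2 : 4 / c' ^ 2 ≤ S ^ 2 / 40 := by
    rw [div_le_div_iff₀ (by positivity) (by norm_num)]
    have := (div_le_iff₀ hS2).1 hc'S
    nlinarith
  linarith

end ChartBoxes

end Literature.Topology.FourManifolds
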